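import Literature.Computability.ImplicitComplexity.STASubjectReduction
import Mathlib.Tactic.Ring
import Mathlib.Tactic.Linarith
import HarnessLib

/-!
# Polynomial bound on β-reduction sequences of `STA` programs (GMR08 Thm. 3.5)

Support file for the `PTIME` soundness half of `STACapturesP`. GMR08 Theorem 3.5 (Deterministic
Polynomial Time Soundness, = GR07 Thm. 4.6 "strong polystep normalisation"): "Let
`Π ▹ Γ ⊢ M : σ`, then `M` can be evaluated to normal form in a number of β-reduction steps
`O(|M|^{d(Π)+1})`", every reduct having size within the same bound. From weighted subject
reduction (`MTyping.subject_reduction`: every β-step strictly decreases `W(Π, r)`, `r ≥ 1`)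
and GMR08 Lemma 3.3 (`|M| ≤ W(Π, r) ≤ r^{d(Π)} |M|`) we derive:

* `MTyping.redSeq_bound` — along ANY reduction sequence `M = M₀ →β M₁ →β ⋯ →β M_L` from a term
  with a weighted derivation of weight `w`: `L ≤ w`, and every `Mᵢ` is typed with weight
  `≤ w - i`, hence `|Mᵢ| ≤ w`;
* `MTyping.encWord` — the data `s̲ : S_m` of a word have weighted derivations of degree `0`,
  rank `|s|` and weight `6|s| + 3` (GMR08 §3.2: "data types … can be typed in STA by derivations
  with degree 0"), for every `m ≥ 1`;
* `polystep_program` — **Thm. 3.5 for programs**: for a closed sum-free `STA` program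
  `⊢ M : !ⁿ S_m ⊸ B` typed with degree `d`, and `t ≥ max d n`, there is a constant `C` such that
  every β-reduction sequence from `M s̲` has length `≤ C · (|s| + 1)^{t+1}` and passes only
  through terms of size `≤ C · (|s| + 1)^{t+1}`.

## References

* [GaboardiMarionRonchidellarocca2008] GMR08, Lemma 3.3, Lemma 3.4, Thm. 3.5, §3.2 (data of
  degree `0`), Def. 3.8.
* [GaboardiRonchiDellaRocca2007] GR07, Thm. 4.6 (strong polystep normalisation).
-/

namespace Literature.Computability.ImplicitComplexity

namespace STA

/-! ### Reduction sequences from a typed term -/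

namespace MTyping

variable {r : ℕ}

/-- **Every reduction sequence is bounded by the weight** (GMR08 Thm. 3.5, qualitative core):
if `Γ ⊢ M : σ` has a weighted derivation of weight `w` (`r ≥ 1`) and
`M = f 0 →β f 1 →β ⋯ →β f L`, then `L ≤ w` and each `f i` (`i ≤ L`) has a derivation of weight
`wᵢ` with `wᵢ + i ≤ w` and degree `≤ d`. [cite: GaboardiMarionRonchidellarocca2008, Thm. 3.5 and Lemma 3.4] -/
theorem redSeq_bound {d w : ℕ} {Γ : Ctx} {M : Term} {σ : SoftTy} (h : MTyping r w d Γ M σ)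
    (hr : 1 ≤ r) (f : ℕ → Term) (L : ℕ) (h0 : f 0 = M)
    (hstep : ∀ i, i < L → Red (f i) (f (i + 1))) :
    L ≤ w ∧ ∀ i, i ≤ L → ∃ d' w', d' ≤ d ∧ w' + i ≤ w ∧ MTyping r w' d' Γ (f i) σ := by
  have key : ∀ i, i ≤ L → ∃ d' w', d' ≤ d ∧ w' + i ≤ w ∧ MTyping r w' d' Γ (f i) σ := by
    intro i
    induction i with
    | zero => intro _; exact ⟨d, w, le_rfl, by omega, by rw [h0]; exact h⟩
    | succ i ih =>
      intro hi
      obtain ⟨d', w', hd', hw', hder⟩ := ih (by omega)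
      obtain ⟨d'', w'', hd'', hw'', hder'⟩ := hder.subject_reduction hr (hstep i (by omega))
      exact ⟨d'', w'', hd''.trans hd', by omega, hder'⟩
  refine ⟨?_, key⟩
  obtain ⟨d', w', -, hw', -⟩ := key L le_rfl
  omega

/-- Sizes along a reduction sequence are bounded by the initial weight. [cite: GaboardiMarionRonchidellarocca2008, Thm. 3.5 and Lemma 3.3] -/
theorem redSeq_size_le {d w : ℕ} {Γ : Ctx} {M : Term} {σ : SoftTy} (h : MTyping r w d Γ M σ)
    (hr : 1 ≤ r) (f : ℕ → Term) (L : ℕ) (h0 : f 0 = M)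
    (hstep : ∀ i, i < L → Red (f i) (f (i + 1))) (i : ℕ) (hi : i ≤ L) : (f i).size ≤ w := by
  obtain ⟨d', w', -, hw', hder⟩ := (h.redSeq_bound hr f L h0 hstep).2 i hi
  exact (hder.size_le hr).trans (by omega)

/-! ### Weighted derivations of the data (GMR08 §3.2) -/

/-- `⊢ 0 : B` with weight `3`, degree `0`, in any empty context. [cite: GaboardiMarionRonchidellarocca2008, §3.2] -/
theorem zero (Γ : Ctx) (hΓ : ∀ i, Γ i = none) : MTyping r 3 0 Γ STA.zero ⟨0, tyB⟩ := by
  refine MTyping.allI (Δ := Γ.shift) ?_ rfl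
  refine MTyping.lam (MTyping.lam ?_)
  have hΔ : ∀ i, Γ.shift i = none := fun i => by simp [Ctx.shift, hΓ i]
  have hax : MTyping r 1 0 (Ctx.cons none (Ctx.cons (some ⟨0, .tvar 0⟩) Γ.shift)) (.var 1)
      ⟨0, .tvar 0⟩ := by
    refine MTyping.ax ⟨rfl, fun j hj => ?_⟩
    rcases j with _ | _ | j
    · rfl
    · exact (hj rfl).elim
    · exact hΔ j
  refine MTyping.weak 0 (.tvar 0) hax rfl ?_
  funext i
  rcases i with _ | _ | j <;> simp [Ctx.cons]

/-- `⊢ 1 : B` with weight `3`, degree `0`, in any empty context. [cite: GaboardiMarionRonchidellarocca2008, §3.2] -/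
theorem one (Γ : Ctx) (hΓ : ∀ i, Γ i = none) : MTyping r 3 0 Γ STA.one ⟨0, tyB⟩ := by
  refine MTyping.allI (Δ := Γ.shift) ?_ rfl
  have hΔ : ∀ i, Γ.shift i = none := fun i => by simp [Ctx.shift, hΓ i]
  have hax : MTyping r 1 0 (Ctx.cons (some ⟨0, .tvar 0⟩) (Ctx.cons none Γ.shift)) (.var 0)
      ⟨0, .tvar 0⟩ := by
    refine MTyping.ax ⟨rfl, fun j hj => ?_⟩
    rcases j with _ | _ | j
    · exact (hj rfl).elim
    · rfl
    · exact hΔ j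
  refine MTyping.lam (MTyping.weak (Γ := Ctx.cons none Γ.shift) 0 (.tvar 0) (MTyping.lam hax) rfl ?_)
  funext i
  rcases i with _ | j <;> simp [Ctx.cons]

/-- Every letter `⊢ b : B` with weight `3`, degree `0`. [cite: GaboardiMarionRonchidellarocca2008, §3.2] -/
theorem encBit (b : Bool) (Γ : Ctx) (hΓ : ∀ i, Γ i = none) :
    MTyping r 3 0 Γ (STA.encBit b) ⟨0, tyB⟩ := by
  cases b
  · exact MTyping.zero Γ hΓ
  · exact MTyping.one Γ hΓ

/-- The chain `c_s b₀ (c_{s+1} b₁ (⋯ z))` with weight `6k + 1` (`k` letters), degree `0`.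
[cite: GaboardiMarionRonchidellarocca2008, §3.2] -/
theorem wordChain (bs : List Bool) (s : ℕ) (hs : 1 ≤ s) :
    MTyping r (6 * bs.length + 1) 0 (wordCtx s (s + bs.length)) (STA.wordChain s bs)
      ⟨0, .tvar 0⟩ := by
  induction bs generalizing s with
  | nil =>
    exact MTyping.ax ⟨wordCtx_zero _ _, fun j hj =>
      wordCtx_of_not_mem hj (by simp only [List.length_nil]; omega)⟩
  | cons b bs ih =>
    have he : s + (b :: bs).length = (s + 1) + bs.length := by simp; omega
    rw [he]
    have h₁ : MTyping r 5 0 (fun i => if i = s then some ⟨0, tyF⟩ else none)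
        (.app (.var s) (STA.encBit b)) ⟨0, .limp 0 (.tvar 0) (.tvar 0)⟩ := by
      have := MTyping.app (r := r) (Γ := fun i => if i = s then some ⟨0, tyF⟩ else none)
        (Γ₂ := Ctx.empty) (fun i => Or.inl ⟨rfl, rfl⟩)
        (MTyping.ax (i := s) (A := tyF) ⟨by simp, fun j hj => by simp [hj]⟩)
        (MTyping.encBit b _ fun _ => rfl)
      simpa [tyF] using this
    have h := MTyping.app (r := r) (Γ := wordCtx s (s + 1 + bs.length)) ?_ h₁ (ih (s + 1) (by omega))
    · have hw : 5 + (6 * bs.length + 1) + 1 = 6 * (b :: bs).length + 1 := by simp; ring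
      rw [hw] at h
      exact h
    · intro i
      by_cases hi : i = s
      · subst hi
        refine Or.inl ⟨?_, wordCtx_of_not_mem (by omega) (by omega)⟩
        rw [wordCtx_of_mem (by omega) (by omega)]
        simp
      · refine Or.inr ⟨by simp [hi], ?_⟩
        by_cases hi0 : i = 0
        · subst hi0; rfl
        · by_cases hrng : s + 1 ≤ i ∧ i < s + 1 + bs.length
          · rw [wordCtx_of_mem hi0 hrng, wordCtx_of_mem hi0 (by omega)]
          · rw [wordCtx_of_not_mem hi0 hrng, wordCtx_of_not_mem hi0 (by omega)]

/-- The body `c b₀ (c b₁ (⋯ z))` of a word with the iterator at slot `q`. [folklore] -/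
def wordBody (q : ℕ) (w : List Bool) : Term :=
  w.foldr (fun b acc => .app (.app (.var q) (STA.encBit b)) acc) (.var 0)

/-- The context `z : α, c_q : !ᵖ (B ⊸ α ⊸ α)`. [folklore] -/
def wordCtx₂ (q p : ℕ) : Ctx := fun i =>
  if i = 0 then some ⟨0, .tvar 0⟩ else if i = q then some ⟨p, tyF⟩ else none

/-- Free variables of the body are `0` and `q`. [folklore] -/
theorem freeIn_wordBody {q : ℕ} {w : List Bool} {i : ℕ} (h : (wordBody q w).FreeIn i) :
    i = 0 ∨ i = q := by
  induction w with
  | nil => simp only [wordBody, List.foldr_nil, Term.FreeIn] at h; exact Or.inl h.symm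
  | cons b w ih =>
    simp only [wordBody, List.foldr_cons, Term.FreeIn] at h
    rcases h with (h | h) | h
    · exact Or.inr h.symm
    · cases b <;> simp [STA.encBit, STA.zero, STA.one, Term.FreeIn] at h
    · exact ih h

/-- Renaming the iterator slot of the body. [folklore] -/
theorem wordBody_rename {q q' : ℕ} {ρ : ℕ → ℕ} (h0 : ρ 0 = 0) (hq : ρ q = q') (w : List Bool) :
    (wordBody q w).rename ρ = wordBody q' w := by
  induction w with
  | nil => simp [wordBody, Term.rename, h0]
  | cons b w ih =>
    simp only [wordBody, List.foldr_cons, Term.rename, encBit_rename, hq] at ih ⊢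
    rw [ih]

/-- Multiplexing the iterator copies of the chain into slot `q`: the body with iterator `q`.
[cite: GaboardiMarionRonchidellarocca2008, Table 2 (m)] -/
theorem wordChain_rename_gen (S : Finset ℕ) (q : ℕ) (h0 : 0 ∉ S) (bs : List Bool) (s : ℕ)
    (hS : ∀ i, s ≤ i → i < s + bs.length → i ∈ S) :
    (STA.wordChain s bs).rename (mpxRen S q) = wordBody q bs := by
  induction bs generalizing s with
  | nil => simp [STA.wordChain, wordBody, Term.rename, mpxRen, h0]
  | cons b bs ih =>
    have hs : s ∈ S := hS s le_rfl (by simp)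
    simp only [STA.wordChain, Term.rename, mpxRen, hs, if_true, encBit_rename, wordBody,
      List.foldr_cons]
    have := ih (s + 1) (fun i hi hi' => hS i (by omega) (by simp; omega))
    simp only [wordBody] at this
    rw [this]

/-- `z : α, c : !ᵖ(B ⊸ α ⊸ α) ⊢ body : α` at every level `p ≥ 1`, for some iterator slot `q ≥ 1`,
with weight `6|w| + 1`, degree `0`, ranks `≤ max |w| 1`. [cite: GaboardiMarionRonchidellarocca2008, §3.2] -/
theorem wordBody_level (w : List Bool) (hr : w.length ≤ r) (hr1 : 1 ≤ r) (p : ℕ) (hp : 1 ≤ p) :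
    ∃ q, 1 ≤ q ∧ MTyping r (6 * w.length + 1) 0 (wordCtx₂ q p) (wordBody q w) ⟨0, .tvar 0⟩ := by
  induction p, hp using Nat.le_induction with
  | base =>
    -- one multiplexor of rank `|w|` on the chain
    refine ⟨2 + w.length, by omega, ?_⟩
    refine MTyping.mpx (σ := ⟨0, tyF⟩) (Finset.Ico 2 (2 + w.length)) (2 + w.length)
      (MTyping.wordChain w 2 (by omega))
      (fun i hi => wordCtx_of_mem (by have := Finset.mem_Ico.mp hi; omega) (Finset.mem_Ico.mp hi))
      (wordCtx_of_not_mem (by omega) (by omega)) (by simpa using hr) ?_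
      (wordChain_rename_gen _ _ (by simp) w 2 (fun i hi hi' => by simp; omega)).symm
    funext i
    by_cases hi0 : i = 0
    · subst hi0
      have h02 : (0 : ℕ) ≠ 2 + w.length := by omega
      simp [Ctx.mpx, wordCtx₂, wordCtx_zero, h02]
    · by_cases hiq : i = 2 + w.length
      · subst hiq
        simp [Ctx.mpx, wordCtx₂, SoftTy.bang]
      · by_cases hmem : i ∈ Finset.Ico 2 (2 + w.length)
        · simp [Ctx.mpx, wordCtx₂, hmem, hi0, hiq]
        · have : ¬(2 ≤ i ∧ i < 2 + w.length) := fun h => hmem (Finset.mem_Ico.2 h)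
          simp [Ctx.mpx, wordCtx₂, hmem, hi0, hiq, wordCtx_of_not_mem hi0 this]
  | succ p hp ih =>
    -- one more multiplexor of rank `1`, moving the iterator to the fresh slot `q + 1`
    obtain ⟨q, hq, hder⟩ := ih
    refine ⟨q + 1, by omega, ?_⟩
    refine MTyping.mpx (σ := ⟨p, tyF⟩) {q} (q + 1) hder (fun i hi => ?_) ?_ (by simpa using hr1)
      ?_ ?_
    · rw [Finset.mem_singleton] at hi
      rw [hi]
      simp [wordCtx₂, show q ≠ 0 by omega]
    · simp [wordCtx₂]
    · funext i
      by_cases hi0 : i = 0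
      · subst hi0; simp [Ctx.mpx, wordCtx₂, show (0 : ℕ) ≠ q by omega]
      · by_cases hiq : i = q
        · subst hiq; simp [Ctx.mpx, wordCtx₂, hi0]
        · by_cases hiq' : i = q + 1
          · subst hiq'; simp [Ctx.mpx, wordCtx₂, SoftTy.bang]
          · simp [Ctx.mpx, wordCtx₂, hi0, hiq, hiq']
    · exact (wordBody_rename (ρ := mpxRen {q} (q + 1)) (by simp [mpxRen, show (0 : ℕ) ≠ q by omega])
        (by simp [mpxRen]) w).symm

/-- **Words are data of degree `0`** at every `S_m`, `m ≥ 1`: `⊢ s̲ : S_m` with weight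
`6|s| + 3`, degree `0`, for every rank parameter `r ≥ max |s| 1`.
[cite: GaboardiMarionRonchidellarocca2008, §3.2] -/
theorem encWord (w : List Bool) (hr : w.length ≤ r) (hr1 : 1 ≤ r) {m : ℕ} (hm : 1 ≤ m) :
    MTyping r (6 * w.length + 3) 0 Ctx.empty (STA.encWord w) ⟨0, tyS m⟩ := by
  obtain ⟨q, hq, hder⟩ := wordBody_level w hr hr1 m hm
  -- move the iterator to slot `1`
  let ρ : ℕ → ℕ := fun i => if i = q then 1 else if i = 1 then q else i
  have hρ0 : ρ 0 = 0 := by simp [ρ, show (0 : ℕ) ≠ q by omega]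
  have hρq : ρ q = 1 := by simp [ρ]
  have hinj : (wordCtx₂ q m).InjOn ρ := by
    intro i₁ i₂ h₁ h₂ he
    have hs : ∀ i, wordCtx₂ q m i ≠ none → i = 0 ∨ i = q := fun i hi => by
      by_cases h0 : i = 0
      · exact Or.inl h0
      · by_cases hq' : i = q
        · exact Or.inr hq'
        · simp [wordCtx₂, h0, hq'] at hi
    rcases hs i₁ h₁ with rfl | rfl <;> rcases hs i₂ h₂ with rfl | rfl
    · rfl
    · rw [hρ0, hρq] at he; cases he
    · rw [hρ0, hρq] at he; cases he
    · rfl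
  have hder₁ := hder.rename_ctx hinj
  have himg : (wordCtx₂ q m).image ρ = wordCtx₂ 1 m := by
    refine Ctx.image_eq_of hinj (fun i hi => ?_) (fun i' hi' => ?_)
    · by_cases hi0 : i = 0
      · subst hi0; rw [hρ0]; rfl
      · by_cases hiq : i = q
        · subst hiq; rw [hρq]; simp [wordCtx₂, hi0]
        · simp [wordCtx₂, hi0, hiq] at hi
    · by_cases hi0 : i' = 0
      · subst hi0; exact ⟨0, by simp [wordCtx₂], hρ0⟩
      · by_cases hi1 : i' = 1
        · subst hi1; exact ⟨q, by simp [wordCtx₂, show q ≠ 0 by omega], hρq⟩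
        · simp [wordCtx₂, hi0, hi1] at hi'
  rw [himg, wordBody_rename hρ0 hρq] at hder₁
  -- close: `λc.λz.body`, then `(∀I)`
  refine MTyping.allI (Δ := Ctx.empty) ?_ rfl
  have hctx : wordCtx₂ 1 m = Ctx.cons (some ⟨0, .tvar 0⟩) (Ctx.cons (some ⟨m, tyF⟩) Ctx.empty) := by
    funext i
    rcases i with _ | _ | i
    · rfl
    · rfl
    · simp [wordCtx₂, Ctx.cons, Ctx.empty]
  rw [hctx] at hder₁
  exact MTyping.lam (MTyping.lam hder₁)

/-- **The level of an applied program, weighted form.** If `⊢ M : !ⁿ S_m ⊸ B` with degree `d`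
and weight `w_M` (ranks `≤ r`, `r ≥ max |s| 1`), then `⊢ M s̲ : B` with degree `max d n` and
weight `w_M + rⁿ (6|s| + 3) + 1`. [cite: GaboardiMarionRonchidellarocca2008, Table 2 (sp), (⊸E); §3.1] -/
theorem app_encWord {d wM n m : ℕ} {M : Term} (h : MTyping r wM d Ctx.empty M (progTy n m))
    (hm : 1 ≤ m) (s : List Bool) (hr : s.length ≤ r) (hr1 : 1 ≤ r) :
    MTyping r (wM + r ^ n * (6 * s.length + 3) + 1) (max d n) Ctx.empty (.app M (STA.encWord s))
      ⟨0, tyB⟩ := by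
  have hw : ∀ k, MTyping r (r ^ k * (6 * s.length + 3)) k Ctx.empty (STA.encWord s) ⟨k, tyS m⟩ := by
    intro k
    induction k with
    | zero => simpa using MTyping.encWord s hr hr1 hm
    | succ k ih =>
      have := MTyping.sp ih (Γ' := Ctx.empty) (by funext i; rfl)
      rw [pow_succ]
      convert this using 1
      ring
  exact MTyping.app (fun _ => Or.inl ⟨rfl, rfl⟩) h (hw n)

end MTyping

/-! ### GMR08 Theorem 3.5 for programs -/

/-- An elementary estimate: `(ℓ + a + 1)^t · (b + 6ℓ + 3) + 1 ≤ ((a+1)^t (b+6) + 1) (ℓ+1)^{t+1}`.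
[folklore] -/
theorem poly_estimate (ℓ a b t : ℕ) :
    (ℓ + a + 1) ^ t * (b + 6 * ℓ + 3) + 1 ≤ ((a + 1) ^ t * (b + 6) + 1) * (ℓ + 1) ^ (t + 1) := by
  have h1 : (ℓ + a + 1) ^ t ≤ (a + 1) ^ t * (ℓ + 1) ^ t := by
    rw [← Nat.mul_pow]
    exact Nat.pow_le_pow_left (by nlinarith) t
  have h2 : b + 6 * ℓ + 3 ≤ (b + 6) * (ℓ + 1) := by nlinarith
  have h3 : 1 ≤ (ℓ + 1) ^ (t + 1) := Nat.one_le_pow _ _ (by omega)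
  calc (ℓ + a + 1) ^ t * (b + 6 * ℓ + 3) + 1
      ≤ (a + 1) ^ t * (ℓ + 1) ^ t * ((b + 6) * (ℓ + 1)) + (ℓ + 1) ^ (t + 1) :=
        Nat.add_le_add (Nat.mul_le_mul h1 h2) h3
    _ = ((a + 1) ^ t * (b + 6) + 1) * (ℓ + 1) ^ (t + 1) := by ring

/-- **The weight of an applied program is polynomial in the input length.** For a closed
sum-free `STA` program `⊢ M : !ⁿ S_m ⊸ B` (`m ≥ 1`) typed with degree `d`, and `t ≥ max d n`, there is
`C` such that every applied term `M s̲` has a weighted derivation in the empty context, at a rank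
parameter `r ≥ 1`, of weight `≤ C · (|s| + 1)^{t+1}`.
[cite: GaboardiMarionRonchidellarocca2008, Thm. 3.5 (with Lemma 3.3)] -/
theorem weight_program {M : Term} {d n m t : ℕ} (hM : M.SumFree) (hd : d ≤ t) (hn : n ≤ t)
    (hm : 1 ≤ m) (hT : Typing d Ctx.empty M (progTy n m)) :
    ∃ C : ℕ, ∀ s : List Bool, ∃ r d' w, 1 ≤ r ∧ MTyping r w d' Ctx.empty (.app M (encWord s)) ⟨0, tyB⟩ ∧
      w ≤ C * (s.length + 1) ^ (t + 1) := by
  obtain ⟨r₀, hr₀⟩ := hT.exists_mtyping hM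
  refine ⟨(r₀ + 1) ^ t * (M.size + 6) + 1, fun s => ?_⟩
  -- rank parameter: at least the rank of `Π_M`, at least `|s|`, at least `1`
  set R := max (max r₀ 1) s.length with hR
  have hR₀ : r₀ ≤ R := le_trans (le_max_left _ _) (le_max_left _ _)
  have hR1 : 1 ≤ R := le_trans (le_max_right _ _) (le_max_left _ _)
  have hRs : s.length ≤ R := le_max_right _ _
  have hRle : R ≤ s.length + r₀ + 1 := by omega
  obtain ⟨wM, hwM⟩ := hr₀ R hR₀
  have happ := hwM.app_encWord hm s hRs hR1
  have hwMle : wM ≤ R ^ d * M.size := hwM.le_pow_mul_size hR1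
  refine ⟨R, max d n, _, hR1, happ, ?_⟩
  -- the weight of `M s̲` is polynomial in `|s|`
  have e1 : R ^ d ≤ (s.length + r₀ + 1) ^ t :=
    (Nat.pow_le_pow_left hRle d).trans (Nat.pow_le_pow_right (by omega) hd)
  have e2 : R ^ n ≤ (s.length + r₀ + 1) ^ t :=
    (Nat.pow_le_pow_left hRle n).trans (Nat.pow_le_pow_right (by omega) hn)
  have e3 : wM + R ^ n * (6 * s.length + 3) + 1 ≤
      (s.length + r₀ + 1) ^ t * (M.size + 6 * s.length + 3) + 1 := by
    have := Nat.mul_le_mul_right M.size e1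
    have := Nat.mul_le_mul_right (6 * s.length + 3) e2
    nlinarith
  exact e3.trans (poly_estimate s.length r₀ M.size t)

/-- **GMR08 Theorem 3.5 (polynomial time soundness) for programs.** Let `⊢ M : !ⁿ S_m ⊸ B`
(`m ≥ 1`) be a closed sum-free `STA` program typed with degree `d`, and `t ≥ max d n` its level.
There is a constant `C` such that for every word `s`, every β-reduction sequence
`M s̲ = N₀ →β N₁ →β ⋯ →β N_L` has length `L ≤ C · (|s| + 1)^{t+1}` and consists of terms of size
`|Nᵢ| ≤ C · (|s| + 1)^{t+1}`: typed programs normalise (by any strategy) in a polynomial number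
of steps through polynomially large terms, the exponent being governed by the level.
[cite: GaboardiMarionRonchidellarocca2008, Thm. 3.5 (with Lemma 3.3, Lemma 3.4, Def. 3.8)] -/
theorem polystep_program {M : Term} {d n m t : ℕ} (hM : M.SumFree) (hd : d ≤ t) (hn : n ≤ t)
    (hm : 1 ≤ m) (hT : Typing d Ctx.empty M (progTy n m)) :
    ∃ C : ℕ, ∀ (s : List Bool) (f : ℕ → Term) (L : ℕ), f 0 = .app M (encWord s) →
      (∀ i, i < L → Red (f i) (f (i + 1))) →
      L ≤ C * (s.length + 1) ^ (t + 1) ∧ ∀ i, i ≤ L → (f i).size ≤ C * (s.length + 1) ^ (t + 1) := by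
  obtain ⟨C, hC⟩ := weight_program hM hd hn hm hT
  refine ⟨C, fun s f L h0 hstep => ?_⟩
  obtain ⟨r, d', w, hr, happ, hw⟩ := hC s
  obtain ⟨hL, -⟩ := happ.redSeq_bound hr f L h0 hstep
  exact ⟨hL.trans hw, fun i hi => (happ.redSeq_size_le hr f L h0 hstep i hi).trans hw⟩

end STA

end Literature.Computability.ImplicitComplexity
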